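import Summits.QuantumFields.YangMills.Theorems.FluctuationComparisonRegPrIntLLargeFieldGasOfEnginePackage
import Literature.MathematicalPhysics.QuantumFieldTheory.Balaban1983to89.B16RatioResummationDefs
import HarnessLib

/-!
# LFG^{can}∘ — THE TWO-GAS ROWS AT DEPTH ZERO ARE INHABITED (G17, px10 lineage): `twoGasRows_depthZero` — at `K = J` (no constrained level below the comparison height) the per-(J,K)
# rows of the TWO-GAS PACKAGE of ✓`enginePackage_of_twoGasPackage` hold with the EMPTY vacuum catalogue, ZERO activities and the trivial identity `ρ(E_∅) = ρ(histGood)` — a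
# NON-VACUITY WITNESS for the row format at the base of Bałaban's induction on the depth `K − J` ([Balaban1985UV3] §C), the rung px10 g17 had to drop at the engine-package level

Cell `ym3-torus` (HUMAN RULING D-0037: rung R3 = continuum `SU(2)` Yang–Mills on `T³` — NOT `d = 4`, NOT infinite volume, NOT a mass gap, NOT the Clay problem); width seat
`ym3-torus-px10` (gen 18); helper of the crux `stmt-QuantumFields-20520` (`--supports … --as helper`, NOT a proof of it).  THEOREMS ONLY: 0 `def`, 0 `instance`, 0 `notation`,
0 `sorry`, default heartbeats.  WHAT IT SHOWS: the text of the rows (catalogue ∕ V-locality ∕ continuity ∕ Kotecký–Preiss (1) in the `(τ·#blocks, κ′·#blocks)` form ∕ hole rows ∕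
numeric rows ∕ the UNNORMALISED identity with its `IsHoleFamily`–`vacCompat` index sets) has no hidden contradiction and degenerates correctly: at depth zero there is no deep label, the
only deep history is `Q = ∅`, `IsHoleFamily (admOf ∅) ∅` selects `S = ∅` only, `Ξ_0 = 1`, and the identity reads `ρ(E_∅)·1 = ρ(histGood)·1`, true by ✓`histGood_eq_histEvent_empty`.
WHAT IT IS NOT: any step of the expansion (depth `≥ 1` is the R600 hand's XL content); ENGINE ∕ LF-INT∘ ∕ `stub_largeFieldFourPtIntCan` ∕ S2β ∕ 20520 NOT proved; `YM3TorusSU2` NOT proved;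
rung R3 = YM₃ on `T³` — NOT `d = 4`, NOT infinite volume, NOT a mass gap, NOT Clay.
References: [Balaban1985UV3] T. Bałaban, CMP 102 (1985): (7) p.257, (41) p.266, §C p.267 (the induction on the number of steps); [KoteckyPreiss1986] CMP 103 (1986) (1).
-/

set_option autoImplicit false

noncomputable section

open Finset MeasureTheory Filter Topology Set
open scoped BigOperators
open Literature.Probability.LatticeModels
open Literature.MathematicalPhysics.QuantumFieldTheory.Balaban1983to89
open Literature.MathematicalPhysics.QuantumFieldTheory.Balaban1983to89.T3ContinuumYM3Torus
open Literature.MathematicalPhysics.QuantumFieldTheory.Balaban1983to89.T3NestedUnitLaws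
open Literature.MathematicalPhysics.QuantumFieldTheory.Balaban1983to89.T3UnitLawDensityEML
open Literature.MathematicalPhysics.QuantumFieldTheory.Balaban1983to89.T3UnitScaleTilt
open Literature.MathematicalPhysics.QuantumFieldTheory.Balaban1983to89.T3TiltDescent
open Literature.MathematicalPhysics.QuantumFieldTheory.Balaban1983to89.T3LevelShift
open Literature.MathematicalPhysics.QuantumFieldTheory.Balaban1983to89.Missing
open Literature.MathematicalPhysics.QuantumFieldTheory.Balaban1983to89.T4Continuum
open Literature.MathematicalPhysics.QuantumFieldTheory.Balaban1983to89.Node00 (touchingGraph SiteTouch)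
open Literature.MathematicalPhysics.QuantumFieldTheory.Balaban1983to89.B5Eq118OneStroke (iterBlockOf)
open Literature.MathematicalPhysics.QuantumFieldTheory.BalabanImbrieJaffe1984to88.BIJ85BlockAveragesTorusK (blkIter)
open Literature.MathematicalPhysics.QuantumFieldTheory.Balaban1983to89.B16RatioResummation (IsHoleFamily vacCompat GCov)
open Summit.QuantumFields.YangMills.Theorems.FluctuationComparisonRegPrIntLHistoryPartition (LFLabel histEvent smallFactor smallFactor_pos histGood_eq_histEvent_empty)

namespace Summit.QuantumFields.YangMills.Theorems.FluctuationComparisonRegPrIntLLargeFieldGasTwoGasRowsDepthZero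

open Classical in
/-- **THE TWO-GAS ROWS AT DEPTH ZERO** (`K = J`): empty catalogue, zero activities, `τ = 1`, `κ′ = 4 + 2 log 26`, `κ_h = κ′ + e^{1∕κ′} + (2 + 2 log 26)`; the identity row is
`ρ(E_∅) = ρ(histGood)` (✓`histGood_eq_histEvent_empty`). [cite: Balaban1985UV3, (7) p.257 and (41) p.266] -/
theorem twoGasRows_depthZero (F : T3Family) (γ b₀ p₀ c a₂ : ℝ) (J μ' : ℕ) :
    ∃ (Λ : Finset (Finset (PBond (F.P J) 0))) (v : GaugeField (F.P J) 0 (Matrix.specialUnitaryGroup (Fin 2) ℂ) → Finset (PBond (F.P J) 0) → ℝ)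
            (h₂ : Finset (LFLabel F J J) → Finset (PBond (F.P J) 0) → GaugeField (F.P J) 0 (Matrix.specialUnitaryGroup (Fin 2) ℂ) → ℝ) (τ κ' κh : ℝ),
            -- the vacuum catalogue: non-empty footprints of touching-connected families of `μ′`-blocks
            (∀ X ∈ Λ, X.Nonempty ∧ ∃ Fc : Finset (Site (F.P J) μ'), ((touchingGraph (SiteTouch (P := F.P J) (j := μ'))).induce (Fc : Set (Site (F.P J) μ'))).Connected ∧
              Fc.biUnion (fun y => Finset.univ.filter (fun b : PBond (F.P J) 0 => iterBlockOf μ' b.src = y)) = X) ∧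
            -- vacuum activities: V-local, continuous on the window, Kotecký–Preiss (1) with size `τ·#blocks` and decay `κ′·#blocks`
            (∀ (X : Finset (PBond (F.P J) 0)) (U U' : GaugeField (F.P J) 0 (Matrix.specialUnitaryGroup (Fin 2) ℂ)), (∀ e ∈ X, U e = U' e) → v U X = v U' X) ∧
            (∀ X : Finset (PBond (F.P J) 0), ContinuousOn (fun U => v U X) {U : GaugeField (F.P J) 0 (Matrix.specialUnitaryGroup (Fin 2) ℂ) | PlaqSmall (θBal F.L γ (c * b₀) p₀ J) U}) ∧
            (∀ U ∈ {U : GaugeField (F.P J) 0 (Matrix.specialUnitaryGroup (Fin 2) ℂ) | PlaqSmall (θBal F.L γ (c * b₀) p₀ J) U},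
              ∀ σ : Finset (PBond (F.P J) 0), ∑ γ' ∈ Finset.univ.filter (fun γ' : Finset (PBond (F.P J) 0) => polyInc γ' σ),
                |v U γ'| * Real.exp (τ * (((γ'.image (fun b : PBond (F.P J) 0 => iterBlockOf μ' b.src)).card : ℕ) : ℝ) +
                  κ' * (((γ'.image (fun b : PBond (F.P J) 0 => iterBlockOf μ' b.src)).card : ℕ) : ℝ)) ≤
                τ * (((σ.image (fun b : PBond (F.P J) 0 => iterBlockOf μ' b.src)).card : ℕ) : ℝ)) ∧
            -- hole activities: V-local, continuous on the window, one small factor per deep hole and block decay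
            (∀ (Q' : Finset (LFLabel F J J)) (X : Finset (PBond (F.P J) 0)) (U U' : GaugeField (F.P J) 0 (Matrix.specialUnitaryGroup (Fin 2) ℂ)),
              (∀ e ∈ X, U e = U' e) → h₂ Q' X U = h₂ Q' X U') ∧
            (∀ (Q' : Finset (LFLabel F J J)) (X : Finset (PBond (F.P J) 0)), ContinuousOn (fun U => h₂ Q' X U) {U : GaugeField (F.P J) 0 (Matrix.specialUnitaryGroup (Fin 2) ℂ) | PlaqSmall (θBal F.L γ (c * b₀) p₀ J) U}) ∧
            (∀ (Q' : Finset (LFLabel F J J)) (X : Finset (PBond (F.P J) 0)) (U : GaugeField (F.P J) 0 (Matrix.specialUnitaryGroup (Fin 2) ℂ)), U ∈ {U : GaugeField (F.P J) 0 (Matrix.specialUnitaryGroup (Fin 2) ℂ) | PlaqSmall (θBal F.L γ (c * b₀) p₀ J) U} →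
              (∀ l ∈ Q', l.1.val < J - J) →
              |h₂ Q' X U| ≤ (∏ l ∈ Q', (if l.1.val < J - J then smallFactor F.L γ b₀ p₀ a₂ (J - l.1.val) else 0)) *
                Real.exp (-(κh * (((X.image (fun b : PBond (F.P J) 0 => iterBlockOf μ' b.src)).card : ℕ) : ℝ)))) ∧
            -- numeric rows: tree decay per block beats the entropy of block animals; the hole decay pays for the attached clusters
            4 + 2 * Real.log 26 ≤ κ' ∧ 0 < τ ∧ κ' + Real.exp (τ / κ') * τ + (2 + 2 * Real.log 26) ≤ κh ∧
            -- THE UNNORMALISED IDENTITY per deep history, a.e. on the window: `ρ(E_Q)·Ξ_v(Λ) = ρ(E_∅)·Σ_S (Π h₂)·Ξ_v(vacCompat Λ S)`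
            (∀ Q : Finset (LFLabel F J J), (∀ l ∈ Q, l.1.val < J - J) →
              ∀ᵐ U ∂fieldMeasure (F.P J) 0 (Matrix.specialUnitaryGroup (Fin 2) ℂ), U ∈ {U : GaugeField (F.P J) 0 (Matrix.specialUnitaryGroup (Fin 2) ℂ) | PlaqSmall (θBal F.L γ (c * b₀) p₀ J) U} →
                (heightDensity F γ (le_refl J) (histEvent F (θBal F.L γ b₀ p₀) J J Q) U : ℂ) *
                    polymerPartitionFunction polyInc (fun X => ((v U X : ℝ) : ℂ)) Λ =
                  (heightDensity F γ (le_refl J) (histGood F ℰp (θBal F.L γ b₀ p₀) J J) U : ℂ) *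
                    ∑ S ∈ (Finset.univ : Finset (Finset (PBond (F.P J) 0))).powerset.filter
                        (IsHoleFamily (fun X => (∃ l ∈ Q, (⟨siteShift (F.sitesPerDir_eq (m := F.m) (K := J) (j := l.1.val + (J - J - l.1.val)) (m' := F.m) (K' := J) (j' := 0)
              (by have := l.1.isLt; omega)) (blkIter (J - J - l.1.val) l.2.src), l.2.μ⟩ : PBond (F.P J) 0) ∈ X) ∧
                          ∃ Fc : Finset (Site (F.P J) μ'), ((touchingGraph (SiteTouch (P := F.P J) (j := μ'))).induce (Fc : Set (Site (F.P J) μ'))).Connected ∧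
                            Fc.biUnion (fun y => Finset.univ.filter (fun b : PBond (F.P J) 0 => iterBlockOf μ' b.src = y)) = X)
                          (Q.image fun l => (⟨siteShift (F.sitesPerDir_eq (m := F.m) (K := J) (j := l.1.val + (J - J - l.1.val)) (m' := F.m) (K' := J) (j' := 0)
              (by have := l.1.isLt; omega)) (blkIter (J - J - l.1.val) l.2.src), l.2.μ⟩ : PBond (F.P J) 0))),
                      (∏ X ∈ S, ((h₂ (Q.filter fun l => (⟨siteShift (F.sitesPerDir_eq (m := F.m) (K := J) (j := l.1.val + (J - J - l.1.val)) (m' := F.m) (K' := J) (j' := 0)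
              (by have := l.1.isLt; omega)) (blkIter (J - J - l.1.val) l.2.src), l.2.μ⟩ : PBond (F.P J) 0) ∈ X) X U : ℝ) : ℂ)) *
                        polymerPartitionFunction polyInc (fun X => ((v U X : ℝ) : ℂ)) (vacCompat Λ S)) := by
  refine ⟨∅, fun _ _ => 0, fun _ _ _ => 0, 1, 4 + 2 * Real.log 26, (4 + 2 * Real.log 26) + Real.exp (1 / (4 + 2 * Real.log 26)) * 1 + (2 + 2 * Real.log 26),
    fun X hX => absurd hX (Finset.notMem_empty X), fun _ _ _ _ => rfl, fun _ => continuousOn_const, fun U _ σ => ?_, fun _ _ _ _ _ => rfl,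
    fun _ _ => continuousOn_const, fun Q' X U _ _ => ?_, le_rfl, one_pos, le_rfl, fun Q hQ => ?_⟩
  · -- (vKP) with zero activities
    simp only [abs_zero, zero_mul, Finset.sum_const_zero]
    positivity
  · -- (hbd) with zero hole activities
    rw [abs_zero]
    refine mul_nonneg (Finset.prod_nonneg fun l _ => ?_) (Real.exp_nonneg _)
    split_ifs
    · exact (smallFactor_pos _ _ _ _ _ _).le
    · exact le_rfl
  · -- (ID): the only deep history is `Q = ∅`
    have hQ0 : Q = ∅ := Finset.eq_empty_of_forall_notMem fun l hl => by have := hQ l hl; omega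
    subst hQ0
    refine Eventually.of_forall fun U _ => ?_
    rw [polymerPartitionFunction_empty, mul_one]
    -- the index set of the right-hand side is `{∅}`
    rw [Finset.sum_eq_single_of_mem (∅ : Finset (Finset (PBond (F.P J) 0)))]
    · rw [Finset.prod_empty, one_mul]
      have hvc : vacCompat (∅ : Finset (Finset (PBond (F.P J) 0))) (∅ : Finset (Finset (PBond (F.P J) 0))) = ∅ := by
        ext γ'; simp [vacCompat]
      rw [hvc, polymerPartitionFunction_empty, mul_one, ← histGood_eq_histEvent_empty _ (le_refl J)]
    · simp only [Finset.mem_filter, Finset.mem_powerset, Finset.empty_subset, true_and]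
      exact ⟨isCompatible_empty, fun b hb => absurd hb (by simp), fun X hX => absurd hX (Finset.notMem_empty X)⟩
    · intro S hS hSne
      exfalso
      simp only [Finset.mem_filter, Finset.mem_powerset] at hS
      obtain ⟨-, -, -, hadm⟩ := hS
      obtain ⟨X, hX⟩ := Finset.nonempty_iff_ne_empty.2 hSne
      obtain ⟨⟨l, hl, -⟩, -⟩ := hadm X hX
      exact Finset.notMem_empty l hl

end Summit.QuantumFields.YangMills.Theorems.FluctuationComparisonRegPrIntLLargeFieldGasTwoGasRowsDepthZero

end
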